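import Summits.BirchSwinnertonDyer.BirchSwinnertonDyer.Theorems.Rank2ObservatoryRank3TamagawaCensusExact
import Summits.BirchSwinnertonDyer.BirchSwinnertonDyer.Theorems.Rank2ObservatoryRank3TamZ1
import Summits.BirchSwinnertonDyer.BirchSwinnertonDyer.Theorems.Rank2ObservatoryRank3TamZ2
import Summits.BirchSwinnertonDyer.BirchSwinnertonDyer.Theorems.Rank2ObservatoryRank3TamZ3
import Summits.BirchSwinnertonDyer.BirchSwinnertonDyer.Theorems.Rank2ObservatoryRank3TamZ4
import HarnessLib

/-!
# BirchSwinnertonDyer — rank ≥ 2 observatory: the KERNEL-EXACT TAMAGAWA CENSUS of the rank-3 table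
# (stage 3: every local Tamagawa number exact; `∏_v c_v` a certified numeral on all 9 487 rows)

HONEST FRAMING: per-curve certified theorems and census instruments; no claim on BSD in rank ≥ 2.

Theorems only (no named fact, no axiom, no hypothesis).  Stage 1 (`Rank2ObservatoryRank3TamagawaCensus`)
certified, for every one of the 9 487 curves of `rank3Table` (all curves of analytic rank 3 with
conductor `< 500 000` in Cremona's table), the complete list of bad places with a KERNEL-CHECKED local
certificate each, hence `∏_v c_v ∈ rowVals` (exact on 5 442 rows); stage 2 (`…CensusExact`) made the
primes of type `IV` / `IV*` exact (6 558 rows exact).  Stage 3 (this file) merges in the kernel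
certificates `TamZ` of `Rank2ObservatoryRank3TamZ1–4` (3 194 certificates on 2 929 rows: the 435 primes of
type `I₀*` and the 2 759 of type `Iₙ*`, soundness `TamZ.sound` from the tree's own proofs of Tate's Step 6/7
c-rules, `Rank2ObservatoryTamagawaIstar*/Izero*`), so that:
* `rank3TamRowsZ` — the linear merge `(i, R, X, Z)`; `rank3TamRowsZ_indices` (kernel): indices `0 … 9486`;
* **`tamagawa_censusZ`** — for every merged row: `∏_v c_v ∈ rowValsZ R X Z`, `= rowValueZ R X Z` when
  every local set is a singleton — and `rank3TamRowsZ_all_exact` (kernel): EVERY row is exact; hence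
* **`tamagawaProduct_certifiedZ`** — for every `i < 9487`, the Tamagawa product of row `i` IS the
  kernel numeral `rowValueZ R X Z` of its merged certificate: ALL 31 050 local Tamagawa numbers and all
  9 487 products of the rank-3 census are now kernel-exact (stage 1: 5 442 rows, stage 2: 6 558);
* kernel statistics: `∏_v c_v = 1` on exactly 459 rows; the largest product is 576 (rows `7507` =
  `431613a2` and `8968` = `481574r2`); 1 227 odd / 8 260 even products; checksum `Σ_rows ∏_v c_v = 174 385`.
TWO IMPLEMENTATIONS behind the data (cell rule): engine 1 (`kernel-tam3/engine1/tam.py` + `tamz.py`, own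
Tate run, Python mirror of every Boolean of `TamZ.check`) = PARI/GP `elllocalred` (Kodaira code, c and
`v_p(Δ_min)` derived from the `TamZ` fields agree at all 3 194 primes: gen-6 table j101307 and the FRESH kit job
j128163, `okKod = okC = okN = 3194`, `okProd = 2929`) = Cremona's `allbsd` column `CP` on all 9 487 products;
engine 0 = the Lean kernel.
References: [Silverman1994] J. H. Silverman, *Advanced Topics in the Arithmetic of Elliptic Curves*,
GTM 151 (1994), IV.9.4; [Tate1975] J. Tate, LNM 476 (1975) §7; [CremonaAlgorithms1997] J. E. Cremona,
*Algorithms for Modular Elliptic Curves*, 2nd ed. (1997) §3.2, Table 1.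
-/

set_option linter.dupNamespace false
set_option autoImplicit false

namespace Summit.BirchSwinnertonDyer.BirchSwinnertonDyer.Rank2Observatory.Tam

/-- ALL kernel supplements: the concatenation of the 4 chunks. [cite: Silverman1994, IV.9.4] -/
def rank3TamZ : List (ℕ × List TamZ) := rank3TamZ1 ++ rank3TamZ2 ++ rank3TamZ3 ++ rank3TamZ4

/-- The LINEAR MERGE of the index-sorted stage-2 rows `(i, R, X)` with the index-sorted kernel
supplements: `(i, R, X, Z)` with `Z = []` when row `i` has no supplement. [folklore] -/
def mergeZ : List (ℕ × List TamC × List TamX) → List (ℕ × List TamZ) →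
    List (ℕ × List TamC × List TamX × List TamZ)
  | [], _ => []
  | (i, R, X) :: rs, [] => (i, R, X, []) :: mergeZ rs []
  | (i, R, X) :: rs, (j, Z) :: zs =>
      if j = i then (i, R, X, Z) :: mergeZ rs zs else (i, R, X, []) :: mergeZ rs ((j, Z) :: zs)

/-- What membership in a merge says. [folklore] -/
theorem mem_mergeZ : ∀ (cs : List (ℕ × List TamC × List TamX)) (zs : List (ℕ × List TamZ)) {i : ℕ}
    {R : List TamC} {X : List TamX} {Z : List TamZ}, (i, R, X, Z) ∈ mergeZ cs zs →
      (i, R, X) ∈ cs ∧ (Z = [] ∨ (i, Z) ∈ zs)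
  | [], _, _, _, _, _, h => by simp [mergeZ] at h
  | (i', R', X') :: rs, [], i, R, X, Z, h => by
    simp only [mergeZ, List.mem_cons, Prod.mk.injEq] at h
    rcases h with ⟨rfl, rfl, rfl, rfl⟩ | h
    · exact ⟨List.mem_cons_self, .inl rfl⟩
    · exact ⟨List.mem_cons_of_mem _ (mem_mergeZ rs [] h).1, (mem_mergeZ rs [] h).2⟩
  | (i', R', X') :: rs, (j, Z') :: zs, i, R, X, Z, h => by
    by_cases hj : j = i'
    · simp only [mergeZ, hj, ↓reduceIte, List.mem_cons, Prod.mk.injEq] at h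
      rcases h with ⟨rfl, rfl, rfl, rfl⟩ | h
      · exact ⟨List.mem_cons_self, .inr (List.mem_cons.mpr (.inl (by rw [hj])))⟩
      · obtain ⟨h1, h2⟩ := mem_mergeZ rs zs h
        exact ⟨List.mem_cons_of_mem _ h1, h2.imp id fun h => List.mem_cons_of_mem _ h⟩
    · simp only [mergeZ, hj, ↓reduceIte, List.mem_cons, Prod.mk.injEq] at h
      rcases h with ⟨rfl, rfl, rfl, rfl⟩ | h
      · exact ⟨List.mem_cons_self, .inl rfl⟩
      · obtain ⟨h1, h2⟩ := mem_mergeZ rs ((j, Z') :: zs) h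
        exact ⟨List.mem_cons_of_mem _ h1, h2⟩

/-- THE KERNEL ROW CERTIFICATES: stage-2 rows merged with the kernel supplements.
[cite: Silverman1994, IV.9.4] -/
def rank3TamRowsZ : List (ℕ × List TamC × List TamX × List TamZ) := mergeZ rank3TamRows rank3TamZ

/-- COVERAGE (kernel): the merged row indices are exactly `0, …, 9486`. [cite: CremonaAlgorithms1997, Table 1] -/
theorem rank3TamRowsZ_indices : rank3TamRowsZ.map (·.1) = List.range 9487 := by
  decide +kernel

/-- All `2929` supplements (`3194` kernel certificates: `1667` of kind `5`, `60` of kind `6`, `1001` of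
kind `7`, `31` of kind `8`, `435` of kind `9`) are consumed by the merge. [cite: Silverman1994, IV.9.4] -/
theorem rank3TamRowsZ_supplemented :
    rank3TamZ.length = 2929 ∧ (rank3TamRowsZ.filter fun x => !x.2.2.2.isEmpty).length = 2929 ∧
    (rank3TamZ.map fun x => x.2.length).sum = 3194 ∧
    ((rank3TamZ.flatMap (·.2)).map (·.kind)).count 5 = 1667 ∧
    ((rank3TamZ.flatMap (·.2)).map (·.kind)).count 6 = 60 ∧
    ((rank3TamZ.flatMap (·.2)).map (·.kind)).count 7 = 1001 ∧
    ((rank3TamZ.flatMap (·.2)).map (·.kind)).count 8 = 31 ∧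
    ((rank3TamZ.flatMap (·.2)).map (·.kind)).count 9 = 435 := by
  refine ⟨?_, ?_, ?_, ?_, ?_, ?_, ?_, ?_⟩ <;> decide +kernel

/-- Every index `i < 9487` has a merged row. [folklore] -/
theorem exists_listedZ {i : ℕ} (hi : i < 9487) : ∃ R X Z, (i, R, X, Z) ∈ rank3TamRowsZ := by
  have hi' : i ∈ rank3TamRowsZ.map (·.1) := by
    rw [rank3TamRowsZ_indices]; exact List.mem_range.mpr hi
  obtain ⟨⟨j, R, X, Z⟩, hm, hj⟩ := List.mem_map.mp hi'
  dsimp only at hj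
  subst hj
  exact ⟨R, X, Z, hm⟩

/-- Every listed kernel supplement checks on its row (the four chunk walks). [cite: Silverman1994, IV.9.4] -/
theorem checkZ_of_mem {i : ℕ} {Z : List TamZ} (hm : (i, Z) ∈ rank3TamZ) (hi : i < rank3Table.length) :
    (Z.all fun F => F.check (rank3Table[i]'hi).intModel) = true := by
  have key : ∀ {ps : List (ℕ × List TamZ)}, tamWalkZ rank3Table 0 ps = true → (i, Z) ∈ ps →
      (Z.all fun F => F.check (rank3Table[i]'hi).intModel) = true := fun h hm' ↦ by
    obtain ⟨-, r, hrc, hc⟩ := entry_of_tamWalkZ _ 0 _ h i Z hm'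
    rw [Nat.sub_zero] at hrc
    obtain ⟨hi', hr⟩ := List.getElem?_eq_some_iff.mp hrc
    rw [← hr] at hc
    exact hc
  rcases List.mem_append.mp hm with hm | hm
  · rcases List.mem_append.mp hm with hm | hm
    · rcases List.mem_append.mp hm with hm | hm
      · exact key rank3Table_tamWalkZ1 hm
      · exact key rank3Table_tamWalkZ2 hm
    · exact key rank3Table_tamWalkZ3 hm
  · exact key rank3Table_tamWalkZ4 hm

/-- The stage-2 row check of a merged stage-2 row (stage-1 census + the exact chunk walks). [cite: Silverman1994, IV.9.4] -/
theorem rowCheckX_of_mem {i : ℕ} {R : List TamC} {X : List TamX} (hm : (i, R, X) ∈ rank3TamRows) :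
    ∃ hi : i < rank3Table.length, TamX.rowCheckX (R.map TamC.toLocal) X (rank3Table[i]'hi).intModel = true := by
  obtain ⟨hR, hX⟩ := mem_mergeX _ _ hm
  obtain ⟨hi, hrow, -, -, -, -⟩ := tamagawa_census hR
  have hc : (X.all fun F => F.check (rank3Table[i]'hi).intModel) = true := by
    rcases hX with rfl | hX
    · rfl
    · exact checkX_of_mem hX hi
  refine ⟨hi, ?_⟩
  simp only [TamX.rowCheckX, Bool.and_eq_true]; exact ⟨hrow, hc⟩

/-- **THE KERNEL TAMAGAWA CENSUS** (NO named fact, NO hypothesis): for every merged `(i, R, X, Z)`, row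
`i` exists, and its Tamagawa product `∏_v c_v` lies in `rowValsZ R X Z` and equals `rowValueZ R X Z` when
every local set is a singleton (which `rank3TamRowsZ_all_exact` certifies for every row).
[cite: Silverman1994, IV.9.4] [cite: CremonaAlgorithms1997, Table 1] -/
theorem tamagawa_censusZ {i : ℕ} {R : List TamC} {X : List TamX} {Z : List TamZ}
    (hm : (i, R, X, Z) ∈ rank3TamRowsZ) :
    ∃ hi : i < rank3Table.length,
      (rank3Table[i]'hi).curve.tamagawaProduct ∈ TamZ.rowValsZ (R.map TamC.toLocal) X Z ∧
      (TamZ.rowExactZ (R.map TamC.toLocal) X Z = true →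
        (rank3Table[i]'hi).curve.tamagawaProduct = TamZ.rowValueZ (R.map TamC.toLocal) X Z) := by
  obtain ⟨hRX, hZ⟩ := mem_mergeZ _ _ hm
  obtain ⟨hi, hrx⟩ := rowCheckX_of_mem hRX
  have hc : (Z.all fun F => F.check (rank3Table[i]'hi).intModel) = true := by
    rcases hZ with rfl | hZ
    · rfl
    · exact checkZ_of_mem hZ hi
  have hGM : ((rank3Table[i]'hi).intModel.baseChange ℚ).IsGloballyMinimal := by
    rw [← Rank3Row.curve_eq_baseChange]
    exact Rank3Row.isGloballyMinimal_of_mem (List.getElem_mem hi)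
  have hcz : TamZ.rowCheckZ (R.map TamC.toLocal) X Z (rank3Table[i]'hi).intModel = true := by
    simp only [TamZ.rowCheckZ, Bool.and_eq_true]; exact ⟨hrx, hc⟩
  refine ⟨hi, ?_, fun hx ↦ ?_⟩
  · rw [Rank3Row.curve_eq_baseChange]; exact TamZ.tamagawaProduct_memZ hcz hGM
  · rw [Rank3Row.curve_eq_baseChange]; exact TamZ.tamagawaProduct_eqZ hcz hGM hx

set_option maxHeartbeats 2000000 in
/-- EVERY merged row is exact: all local value sets are singletons (kernel). [cite: Silverman1994, IV.9.4] -/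
theorem rank3TamRowsZ_all_exact :
    (rank3TamRowsZ.all fun x => TamZ.rowExactZ (x.2.1.map TamC.toLocal) x.2.2.1 x.2.2.2) = true := by
  decide +kernel

/-- **Headline**: for EVERY row `i < 9487` of the rank-3 census, the Tamagawa product `∏_v c_v` IS the
kernel numeral `rowValueZ R X Z` of its merged certificate `(i, R, X, Z) ∈ rank3TamRowsZ` — NO named fact,
NO hypothesis. [cite: Silverman1994, IV.9.4] [cite: CremonaAlgorithms1997, Table 1] -/
theorem tamagawaProduct_certifiedZ (i : ℕ) (hi : i < rank3Table.length) :
    ∃ (R : List TamC) (X : List TamX) (Z : List TamZ), (i, R, X, Z) ∈ rank3TamRowsZ ∧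
      (rank3Table[i]'hi).curve.tamagawaProduct = TamZ.rowValueZ (R.map TamC.toLocal) X Z := by
  obtain ⟨R, X, Z, hm⟩ := exists_listedZ (i := i) (by rw [rank3Table_length] at hi; exact hi)
  obtain ⟨_, -, hex⟩ := tamagawa_censusZ hm
  exact ⟨R, X, Z, hm, hex (List.all_eq_true.mp rank3TamRowsZ_all_exact _ hm)⟩

/-! ### Kernel-counted statistics of the exact census -/

set_option maxHeartbeats 2000000 in
/-- LOCAL exactness: all `31050` certified local Tamagawa numbers are kernel-exact singletons
(stage 1: `26433`, stage 2: `27856`). [cite: Silverman1994, IV.9.4] -/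
theorem rank3TamRowsZ_local_exact_count :
    (rank3TamRowsZ.map fun x => x.2.1.length).sum = 31050 ∧
    ((rank3TamRowsZ.flatMap fun x =>
      (x.2.1.map TamC.toLocal).map fun E => (TamZ.valsZ x.2.2.2 x.2.2.1 E).length).count 1) = 31050 := by
  refine ⟨?_, ?_⟩ <;> decide +kernel

set_option maxHeartbeats 2000000 in
/-- `∏_v c_v = 1` on exactly `459` rows (stage 2 knew `458`); `1227` rows have an odd product, `8260` an
even one. [cite: CremonaAlgorithms1997, Table 1] -/
theorem rank3TamRowsZ_value_counts :
    (rank3TamRowsZ.filter fun x => decide (TamZ.rowValueZ (x.2.1.map TamC.toLocal) x.2.2.1 x.2.2.2 = 1)).length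
      = 459 ∧
    (rank3TamRowsZ.filter fun x => decide (TamZ.rowValueZ (x.2.1.map TamC.toLocal) x.2.2.1 x.2.2.2 % 2 = 1)).length
      = 1227 ∧
    (rank3TamRowsZ.filter fun x => decide (TamZ.rowValueZ (x.2.1.map TamC.toLocal) x.2.2.1 x.2.2.2 % 2 = 0)).length
      = 8260 := by
  refine ⟨?_, ?_, ?_⟩ <;> decide +kernel

set_option maxHeartbeats 2000000 in
/-- The largest Tamagawa product in the rank-3 census is `576`, attained at rows `7507` (`431613a2`) and
`8968` (`481574r2`); checksum `Σ_rows ∏_v c_v = 174385` (= engine 1 = PARI = allbsd).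
[cite: CremonaAlgorithms1997, Table 1] -/
theorem rank3TamRowsZ_value_max_sum :
    (rank3TamRowsZ.all fun x => decide (TamZ.rowValueZ (x.2.1.map TamC.toLocal) x.2.2.1 x.2.2.2 ≤ 576)) = true ∧
    ((rank3TamRowsZ.filter fun x =>
      decide (TamZ.rowValueZ (x.2.1.map TamC.toLocal) x.2.2.1 x.2.2.2 = 576)).map (·.1)) = [7507, 8968] ∧
    (rank3TamRowsZ.map fun x => TamZ.rowValueZ (x.2.1.map TamC.toLocal) x.2.2.1 x.2.2.2).sum = 174385 := by
  refine ⟨?_, ?_, ?_⟩ <;> decide +kernel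

end Summit.BirchSwinnertonDyer.BirchSwinnertonDyer.Rank2Observatory.Tam
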